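import Literature.AnabelianGeometry.EtaleTheta.ThetaCoversKummerTwistSubgroups

/-!
# The Kummer-twisted Heisenberg toy: the SCALING AUTOMORPHISM `Θ_k` ("labels `↦ k ·` labels") and the
# double-coset invariant it moves

Mochizuki, *The Étale Theta Function …* [EtTh], Publ. RIMS 45 (2009), §2, Cor 2.9 p.43 ("these bijections are
preserved by arbitrary isomorphisms `γ` as in Corollary 2.8").  PURE FINITE GROUP THEORY over
`ThetaCoversKummerTwistSubgroups.lean` (no claim about print).  For units `k, m ∈ ℤ/l` with `k m = 1`:

* `linEquiv k m` — the linear automorphism `(x, y, z) ↦ (x, (k−1) x + k y, m z)` of `(ℤ/l)³` (inverse: the same with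
  `k, m` swapped); `dihEquiv k m` — the automorphism `r^i ↦ r^{k i}`, `s r^i ↦ s r^{1 − k + k i}` of `D_l` (it fixes the
  inversion `s r` and raises `r` to the `k`-th power); they are compatible with the twisted action, whence
* **`Theta k m : kumPiC l ≃* kumPiC l`** (`SemidirectProduct.congr`), and `Theta` PRESERVES every structural subgroup of
  the toy: `kumPiX, kumZ, kumDx, kumH, kumHp, kumE, kumS, kumXuu, kumCuu` and `Ker(z)` (`mem_*_theta_iff`);
* the invariant `cls : D_l → ℤ/l` (`r^i ↦ i`, `s r^j ↦ j − 1`), constant UP TO SIGN on the double cosets of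
  `{1, s r}` on both sides (`cls_mul_of_mem`), with `cls (r^1) = 1` but `cls (Θ r^1) = k` — so for `k ≠ ±1` the automorphism
  moves the double coset of `r` (used by the tempered model to refute the typed `Cor29_preserved` while the typed
  `Cor29_card` count holds).

Consumer: `Discharge/Sec2KummerTwistCor29.lean` (abc-iut cell, seat abc-iut-f-141). [folklore]
-/

namespace Literature.AnabelianGeometry.EtaleTheta

namespace ThetaCovers

namespace KummerWitness

open Multiplicative HeisenbergWitness

variable (l : ℕ)

/-! ## 1. The linear part -/

/-- `(x, y, z) ↦ (x, (k−1) x + k y, m z)`. (toy bookkeeping; no claim about print) [cite: MochizukiEtTh2009, Cor 2.9 p.43] -/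
def linFun (k m : ZMod l) (p : ZMod l × ZMod l × ZMod l) : ZMod l × ZMod l × ZMod l :=
  (p.1, (k - 1) * p.1 + k * p.2.1, m * p.2.2)

/-- `linFun m k ∘ linFun k m = id` when `k m = 1`. (toy bookkeeping; no claim about print) [cite: MochizukiEtTh2009, Cor 2.9 p.43] -/
theorem linFun_linFun {k m : ZMod l} (hkm : k * m = 1) (p : ZMod l × ZMod l × ZMod l) :
    linFun l m k (linFun l k m p) = p := by
  unfold linFun
  ext <;> simp only
  · linear_combination (p.1 + p.2.1) * hkm
  · linear_combination p.2.2 * hkm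

/-- `linFun` is additive. (toy bookkeeping; no claim about print) [cite: MochizukiEtTh2009, Cor 2.9 p.43] -/
theorem linFun_add (k m : ZMod l) (p q : ZMod l × ZMod l × ZMod l) :
    linFun l k m (p + q) = linFun l k m p + linFun l k m q := by
  unfold linFun
  ext <;> simp only [Prod.fst_add, Prod.snd_add, Prod.mk_add_mk] <;> ring

/-- The linear part as an automorphism of the multiplicative copy of `(ℤ/l)³`. (toy bookkeeping; no claim about print)
[cite: MochizukiEtTh2009, Cor 2.9 p.43] -/
def linEquiv (k m : ZMod l) (hkm : k * m = 1) :
    Multiplicative (ZMod l × ZMod l × ZMod l) ≃* Multiplicative (ZMod l × ZMod l × ZMod l) where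
  toFun x := ofAdd (linFun l k m x.toAdd)
  invFun x := ofAdd (linFun l m k x.toAdd)
  left_inv x := by
    apply toAdd.injective
    simp only [toAdd_ofAdd, linFun_linFun l hkm]
  right_inv x := by
    apply toAdd.injective
    simp only [toAdd_ofAdd, linFun_linFun l ((mul_comm m k).trans hkm)]
  map_mul' x y := by
    apply toAdd.injective
    simp only [toAdd_ofAdd, toAdd_mul, linFun_add]

/-- Coordinates of `linEquiv`. (toy bookkeeping; no claim about print) [cite: MochizukiEtTh2009, Cor 2.9 p.43] -/
@[simp] theorem toAdd_linEquiv (k m : ZMod l) (hkm : k * m = 1) (x : Multiplicative (ZMod l × ZMod l × ZMod l)) :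
    toAdd (linEquiv l k m hkm x) = linFun l k m (toAdd x) := rfl

/-! ## 2. The dihedral part -/

/-- `r^i ↦ r^{k i}`, `s r^i ↦ s r^{1 − k + k i}`. (toy bookkeeping; no claim about print) [cite: MochizukiEtTh2009, Cor 2.9 p.43] -/
def dihFun (k : ZMod l) : DihedralGroup l → DihedralGroup l
  | DihedralGroup.r i => DihedralGroup.r (k * i)
  | DihedralGroup.sr i => DihedralGroup.sr (1 - k + k * i)

/-- `dihFun` on a rotation. (toy bookkeeping; no claim about print) [cite: MochizukiEtTh2009, Cor 2.9 p.43] -/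
@[simp] theorem dihFun_r (k i : ZMod l) : dihFun l k (DihedralGroup.r i) = DihedralGroup.r (k * i) := rfl

/-- `dihFun` on a reflection. (toy bookkeeping; no claim about print) [cite: MochizukiEtTh2009, Cor 2.9 p.43] -/
@[simp] theorem dihFun_sr (k i : ZMod l) : dihFun l k (DihedralGroup.sr i) = DihedralGroup.sr (1 - k + k * i) := rfl

/-- `dihFun m ∘ dihFun k = id` when `k m = 1`. (toy bookkeeping; no claim about print) [cite: MochizukiEtTh2009, Cor 2.9 p.43] -/
theorem dihFun_dihFun {k m : ZMod l} (hkm : k * m = 1) (d : DihedralGroup l) : dihFun l m (dihFun l k d) = d := by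
  rcases d with i | i
  · rw [dihFun_r, dihFun_r]
    exact congrArg DihedralGroup.r (by linear_combination i * hkm)
  · rw [dihFun_sr, dihFun_sr]
    exact congrArg DihedralGroup.sr (by linear_combination (i - 1) * hkm)

/-- `dihFun k` is multiplicative. (toy bookkeeping; no claim about print) [cite: MochizukiEtTh2009, Cor 2.9 p.43] -/
theorem dihFun_mul (k : ZMod l) (d d' : DihedralGroup l) : dihFun l k (d * d') = dihFun l k d * dihFun l k d' := by
  rcases d with i | i <;> rcases d' with j | j
  · rw [DihedralGroup.r_mul_r, dihFun_r, dihFun_r, dihFun_r, DihedralGroup.r_mul_r]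
    exact congrArg DihedralGroup.r (by ring)
  · rw [DihedralGroup.r_mul_sr, dihFun_sr, dihFun_r, dihFun_sr, DihedralGroup.r_mul_sr]
    exact congrArg DihedralGroup.sr (by ring)
  · rw [DihedralGroup.sr_mul_r, dihFun_sr, dihFun_sr, dihFun_r, DihedralGroup.sr_mul_r]
    exact congrArg DihedralGroup.sr (by ring)
  · rw [DihedralGroup.sr_mul_sr, dihFun_r, dihFun_sr, dihFun_sr, DihedralGroup.sr_mul_sr]
    exact congrArg DihedralGroup.r (by ring)

/-- The dihedral part as an automorphism of `D_l`. (toy bookkeeping; no claim about print) [cite: MochizukiEtTh2009, Cor 2.9 p.43] -/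
def dihEquiv (k m : ZMod l) (hkm : k * m = 1) : DihedralGroup l ≃* DihedralGroup l where
  toFun := dihFun l k
  invFun := dihFun l m
  left_inv := dihFun_dihFun l hkm
  right_inv := dihFun_dihFun l ((mul_comm m k).trans hkm)
  map_mul' := dihFun_mul l k

/-- `dihEquiv` is `dihFun`. (toy bookkeeping; no claim about print) [cite: MochizukiEtTh2009, Cor 2.9 p.43] -/
@[simp] theorem dihEquiv_apply (k m : ZMod l) (hkm : k * m = 1) (d : DihedralGroup l) : dihEquiv l k m hkm d = dihFun l k d := rfl

/-! ## 3. Compatibility with the twisted action and the automorphism `Θ` -/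

/-- Coordinates of `linFun ∘ act(d)` versus `act(dihFun d) ∘ linFun` — the three identities (given `k m = 1`).
(toy bookkeeping; no claim about print) [cite: MochizukiEtTh2009, Cor 2.9 p.43] -/
theorem linFun_actFun {k m : ZMod l} (hkm : k * m = 1) (d : DihedralGroup l) (p : ZMod l × ZMod l × ZMod l) :
    linFun l k m (toAdd (theta l d (ofAdd p))) = toAdd (theta l (dihFun l k d) (ofAdd (linFun l k m p))) := by
  rcases d with i | i
  · simp only [theta_r, dihFun_r, linFun]
    ext
    · simp only [toAdd_act_fst, toAdd_ofAdd, Units.val_one]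
      linear_combination (i * p.2.2) * hkm
    · simp only [toAdd_act_snd_fst, toAdd_act_fst, toAdd_ofAdd, Units.val_one]
      linear_combination ((k * i * i - i) * p.2.2) * hkm
    · simp only [toAdd_act_snd_snd, toAdd_ofAdd]
  · simp only [theta_sr, dihFun_sr, linFun]
    ext
    · simp only [toAdd_act_fst, toAdd_ofAdd, Units.val_neg, Units.val_one]
      linear_combination (-((i - 1) * p.2.2)) * hkm
    · simp only [toAdd_act_snd_fst, toAdd_act_fst, toAdd_ofAdd, Units.val_neg, Units.val_one]
      linear_combination ((1 - k + k * i) * (i - 1) * p.2.2) * hkm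
    · simp only [toAdd_act_snd_snd, toAdd_ofAdd]

/-- The compatibility `(theta d) ≫ lin = lin ≫ theta (dihFun d)` required by `SemidirectProduct.congr`. (toy bookkeeping; no
claim about print) [cite: MochizukiEtTh2009, Cor 2.9 p.43] -/
theorem theta_trans_linEquiv {k m : ZMod l} (hkm : k * m = 1) (d : DihedralGroup l) :
    (theta l d).trans (linEquiv l k m hkm) = (linEquiv l k m hkm).trans (theta l (dihEquiv l k m hkm d)) := by
  ext x : 1
  apply toAdd.injective
  change linFun l k m (toAdd (theta l d x)) = toAdd (theta l (dihFun l k d) (ofAdd (linFun l k m (toAdd x))))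
  rw [← linFun_actFun l hkm d (toAdd x), ofAdd_toAdd]

/-- **The scaling automorphism `Θ_k` of the twisted toy** (`k m = 1`): `(x, y, z) ⋊ d ↦ (x, (k−1)x + ky, mz) ⋊ δ_k(d)`.
(toy bookkeeping; no claim about print) [cite: MochizukiEtTh2009, Cor 2.9 p.43] -/
def Theta (k m : ZMod l) (hkm : k * m = 1) : kumPiC l ≃* kumPiC l :=
  SemidirectProduct.congr (linEquiv l k m hkm) (dihEquiv l k m hkm) (theta_trans_linEquiv l hkm)

variable {k m : ZMod l} (hkm : k * m = 1)

/-- `D_l`-part of `Θ g`. (toy bookkeeping; no claim about print) [cite: MochizukiEtTh2009, Cor 2.9 p.43] -/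
@[simp] theorem Theta_right (g : kumPiC l) : (Theta l k m hkm g).right = dihFun l k g.right := rfl

/-- `x(Θ g) = x(g)`. (toy bookkeeping; no claim about print) [cite: MochizukiEtTh2009, Cor 2.9 p.43] -/
@[simp] theorem ξ_Theta (g : kumPiC l) : ξ l (Theta l k m hkm g) = ξ l g := rfl

/-- `y(Θ g) = (k−1) x(g) + k y(g)`. (toy bookkeeping; no claim about print) [cite: MochizukiEtTh2009, Cor 2.9 p.43] -/
@[simp] theorem υ_Theta (g : kumPiC l) : υ l (Theta l k m hkm g) = (k - 1) * ξ l g + k * υ l g := rfl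

/-- `z(Θ g) = m z(g)`. (toy bookkeeping; no claim about print) [cite: MochizukiEtTh2009, Cor 2.9 p.43] -/
@[simp] theorem ζ_Theta (g : kumPiC l) : ζ l (Theta l k m hkm g) = m * ζ l g := rfl

/-! ## 4. `Θ` preserves the structural subgroups -/

include hkm

/-- `k` is a unit: `k a = 0 ↔ a = 0`. (toy bookkeeping; no claim about print) [cite: MochizukiEtTh2009, Cor 2.9 p.43] -/
theorem mul_eq_zero_iff_of_unit (a : ZMod l) : k * a = 0 ↔ a = 0 := by
  constructor
  · intro h
    have := congrArg (fun t => m * t) h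
    simp only [mul_zero] at this
    linear_combination this + (-a) * hkm
  · rintro rfl
    exact mul_zero k

/-- `m` is a unit: `m a = 0 ↔ a = 0`. (toy bookkeeping; no claim about print) [cite: MochizukiEtTh2009, Cor 2.9 p.43] -/
theorem mul_eq_zero_iff_of_unit' (a : ZMod l) : m * a = 0 ↔ a = 0 :=
  mul_eq_zero_iff_of_unit l ((mul_comm m k).trans hkm) a

/-- `δ_k d = 1 ↔ d = 1`. (toy bookkeeping; no claim about print) [cite: MochizukiEtTh2009, Cor 2.9 p.43] -/
theorem dihFun_eq_one_iff (d : DihedralGroup l) : dihFun l k d = 1 ↔ d = 1 := by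
  rcases d with i | i
  · rw [dihFun_r, DihedralGroup.one_def, DihedralGroup.r.injEq, DihedralGroup.r.injEq, mul_eq_zero_iff_of_unit l hkm]
  · rw [dihFun_sr, DihedralGroup.one_def]
    exact ⟨fun h => (by cases h), fun h => (by cases h)⟩

/-- `δ_k d = s r ↔ d = s r`. (toy bookkeeping; no claim about print) [cite: MochizukiEtTh2009, Cor 2.9 p.43] -/
theorem dihFun_eq_sr_one_iff (d : DihedralGroup l) : dihFun l k d = DihedralGroup.sr 1 ↔ d = DihedralGroup.sr 1 := by
  rcases d with i | i
  · rw [dihFun_r]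
    exact ⟨fun h => (by cases h), fun h => (by cases h)⟩
  · rw [dihFun_sr, DihedralGroup.sr.injEq, DihedralGroup.sr.injEq]
    constructor
    · intro h
      have h' : k * (i - 1) = 0 := by linear_combination h
      have := (mul_eq_zero_iff_of_unit l hkm _).mp h'
      linear_combination this
    · rintro rfl
      ring

omit hkm in
/-- `δ_k d` is a rotation iff `d` is. (toy bookkeeping; no claim about print) [cite: MochizukiEtTh2009, Cor 2.9 p.43] -/
theorem dihFun_isRotation_iff (d : DihedralGroup l) : (∃ i, dihFun l k d = DihedralGroup.r i) ↔ ∃ i, d = DihedralGroup.r i := by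
  rcases d with i | i
  · exact ⟨fun _ => ⟨i, rfl⟩, fun _ => ⟨k * i, rfl⟩⟩
  · constructor
    · rintro ⟨j, hj⟩; cases hj
    · rintro ⟨j, hj⟩; cases hj

/-- `Θ` preserves `Π_X`. (toy bookkeeping; no claim about print) [cite: MochizukiEtTh2009, Cor 2.9 p.43] -/
theorem mem_kumPiX_theta_iff (g : kumPiC l) : Theta l k m hkm g ∈ kumPiX l ↔ g ∈ kumPiX l := by
  rw [mem_kumPiX, mem_kumPiX, Theta_right, dihFun_isRotation_iff l (k := k)]

/-- `Θ` preserves `Ker(z)`. (toy bookkeeping; no claim about print) [cite: MochizukiEtTh2009, Cor 2.9 p.43] -/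
theorem mem_ker_aug_theta_iff (g : kumPiC l) : Theta l k m hkm g ∈ (aug l).ker ↔ g ∈ (aug l).ker := by
  rw [mem_ker_aug, mem_ker_aug, ζ_Theta, mul_eq_zero_iff_of_unit' l hkm]

/-- `Θ` preserves the centre. (toy bookkeeping; no claim about print) [cite: MochizukiEtTh2009, Cor 2.9 p.43] -/
theorem mem_kumZ_theta_iff (g : kumPiC l) : Theta l k m hkm g ∈ kumZ l ↔ g ∈ kumZ l := by
  rw [mem_kumZ, mem_kumZ, Theta_right, dihFun_eq_one_iff l hkm, ξ_Theta, ζ_Theta, mul_eq_zero_iff_of_unit' l hkm]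

/-- `Θ` preserves `D_x`. (toy bookkeeping; no claim about print) [cite: MochizukiEtTh2009, Cor 2.9 p.43] -/
theorem mem_kumDx_theta_iff (g : kumPiC l) : Theta l k m hkm g ∈ kumDx l ↔ g ∈ kumDx l := by
  rw [mem_kumDx, mem_kumDx, Theta_right, dihFun_eq_one_iff l hkm, ξ_Theta]

/-- `Θ` preserves `Π_X̲`-part. (toy bookkeeping; no claim about print) [cite: MochizukiEtTh2009, Cor 2.9 p.43] -/
theorem mem_kumH_theta_iff (g : kumPiC l) : Theta l k m hkm g ∈ kumH l ↔ g ∈ kumH l := by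
  rw [mem_kumH, mem_kumH, Theta_right, dihFun_eq_one_iff l hkm]

/-- `Θ` preserves `Π_C̲`-part. (toy bookkeeping; no claim about print) [cite: MochizukiEtTh2009, Cor 2.9 p.43] -/
theorem mem_kumHp_theta_iff (g : kumPiC l) : Theta l k m hkm g ∈ kumHp l ↔ g ∈ kumHp l := by
  rw [mem_kumHp, mem_kumHp, Theta_right, dihFun_eq_one_iff l hkm, dihFun_eq_sr_one_iff l hkm]

/-- The linear part fixes the line `y = −x`: `x + ((k−1)x + ky) = k(x + y)`. (toy bookkeeping; no claim about print)
[cite: MochizukiEtTh2009, Cor 2.9 p.43] -/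
theorem ξ_add_υ_theta (g : kumPiC l) : ξ l (Theta l k m hkm g) + υ l (Theta l k m hkm g) = k * (ξ l g + υ l g) := by
  rw [ξ_Theta, υ_Theta]; ring

/-- `Θ` preserves `E`. (toy bookkeeping; no claim about print) [cite: MochizukiEtTh2009, Cor 2.9 p.43] -/
theorem mem_kumE_theta_iff (g : kumPiC l) : Theta l k m hkm g ∈ kumE l ↔ g ∈ kumE l := by
  rw [mem_kumE, mem_kumE, Theta_right, dihFun_eq_one_iff l hkm, ξ_add_υ_theta l hkm, mul_eq_zero_iff_of_unit l hkm,
    ζ_Theta, mul_eq_zero_iff_of_unit' l hkm]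

/-- `Θ` preserves `S`. (toy bookkeeping; no claim about print) [cite: MochizukiEtTh2009, Cor 2.9 p.43] -/
theorem mem_kumS_theta_iff (g : kumPiC l) : Theta l k m hkm g ∈ kumS l ↔ g ∈ kumS l := by
  rw [mem_kumS, mem_kumS, Theta_right, dihFun_eq_one_iff l hkm, ξ_Theta, υ_Theta]
  constructor
  · rintro ⟨h1, h2, h3⟩
    rw [h2, mul_zero, zero_add, mul_eq_zero_iff_of_unit l hkm] at h3
    exact ⟨h1, h2, h3⟩
  · rintro ⟨h1, h2, h3⟩
    exact ⟨h1, h2, by rw [h2, h3, mul_zero, mul_zero, add_zero]⟩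

/-- `Θ` preserves `Π_X̲̲`-part. (toy bookkeeping; no claim about print) [cite: MochizukiEtTh2009, Cor 2.9 p.43] -/
theorem mem_kumXuu_theta_iff (g : kumPiC l) : Theta l k m hkm g ∈ kumXuu l ↔ g ∈ kumXuu l := by
  rw [mem_kumXuu, mem_kumXuu, Theta_right, dihFun_eq_one_iff l hkm, ξ_add_υ_theta l hkm, mul_eq_zero_iff_of_unit l hkm]

/-- `Θ` preserves `Π_C̲̲`-part. (toy bookkeeping; no claim about print) [cite: MochizukiEtTh2009, Cor 2.9 p.43] -/
theorem mem_kumCuu_theta_iff (g : kumPiC l) : Theta l k m hkm g ∈ kumCuu l ↔ g ∈ kumCuu l := by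
  rw [mem_kumCuu, mem_kumCuu, Theta_right, dihFun_eq_one_iff l hkm, dihFun_eq_sr_one_iff l hkm, ξ_add_υ_theta l hkm,
    mul_eq_zero_iff_of_unit l hkm]

omit hkm in
/-- A subgroup stable in both directions under an automorphism `e` is mapped onto itself. (toy bookkeeping; no claim about print)
[cite: MochizukiEtTh2009, Cor 2.9 p.43] -/
theorem map_equiv_eq_of_iff {G : Type*} [Group G] (e : G ≃* G) (K : Subgroup G) (h : ∀ g, e g ∈ K ↔ g ∈ K) :
    K.map e.toMonoidHom = K := by
  ext x
  rw [Subgroup.mem_map_equiv, ← h (e.symm x), MulEquiv.apply_symm_apply]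

/-! ## 5. The double-coset invariant on `D_l` -/

omit hkm

/-- `cls (r^i) = i`, `cls (s r^j) = j − 1`: constant up to sign on the `{1, s r}`-double cosets. (toy bookkeeping; no claim about
print) [cite: MochizukiEtTh2009, Cor 2.9 p.43] -/
def cls : DihedralGroup l → ZMod l
  | DihedralGroup.r i => i
  | DihedralGroup.sr j => j - 1

/-- `cls (r^i) = i`. (toy bookkeeping; no claim about print) [cite: MochizukiEtTh2009, Cor 2.9 p.43] -/
@[simp] theorem cls_r (i : ZMod l) : cls l (DihedralGroup.r i) = i := rfl

/-- `cls (s r^j) = j − 1`. (toy bookkeeping; no claim about print) [cite: MochizukiEtTh2009, Cor 2.9 p.43] -/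
@[simp] theorem cls_sr (j : ZMod l) : cls l (DihedralGroup.sr j) = j - 1 := rfl

/-- **Invariance up to sign**: for `d₁, d₂ ∈ {1, s r}`, `cls (d₁ d d₂) = ± cls d`. (toy bookkeeping; no claim about print)
[cite: MochizukiEtTh2009, Cor 2.9 p.43] -/
theorem cls_mul_of_mem {d₁ d d₂ : DihedralGroup l} (h₁ : d₁ = 1 ∨ d₁ = DihedralGroup.sr 1)
    (h₂ : d₂ = 1 ∨ d₂ = DihedralGroup.sr 1) : cls l (d₁ * d * d₂) = cls l d ∨ cls l (d₁ * d * d₂) = -cls l d := by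
  rcases h₁ with rfl | rfl <;> rcases h₂ with rfl | rfl <;> rcases d with i | i
  · left; rw [one_mul, mul_one]
  · left; rw [one_mul, mul_one]
  · right; rw [one_mul, DihedralGroup.r_mul_sr, cls_sr, cls_r]; ring
  · right; rw [one_mul, DihedralGroup.sr_mul_sr, cls_r, cls_sr]; ring
  · left; rw [mul_one, DihedralGroup.sr_mul_r, cls_sr, cls_r]; ring
  · left; rw [mul_one, DihedralGroup.sr_mul_sr, cls_r, cls_sr]
  · right; rw [DihedralGroup.sr_mul_r, DihedralGroup.sr_mul_sr, cls_r, cls_r]; ring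
  · right; rw [DihedralGroup.sr_mul_sr, DihedralGroup.r_mul_sr, cls_sr, cls_sr]; ring

/-- `cls (Θ_k r) = k`. (toy bookkeeping; no claim about print) [cite: MochizukiEtTh2009, Cor 2.9 p.43] -/
theorem cls_dihFun_r_one (k : ZMod l) : cls l (dihFun l k (DihedralGroup.r 1)) = k := by
  rw [dihFun_r, mul_one, cls_r]

end KummerWitness

end ThetaCovers

end Literature.AnabelianGeometry.EtaleTheta
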